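import Summits.AnomalousDissipation.AnomalousDissipation.Theorems.MomentParityCubicParityLoudDiagonalClassificationLattice

/-!
# Lattice combinatorics of the classification of effective Casimir blocks, II: all frequencies

Helper file for stub `stub_diagonalClassification` (S3b) of the line `farkas-split-menu` of crux
`MomentParity.CubicParityLoud`.  Continuation of `…DiagonalClassificationLattice`: with the same
abstract hypotheses plus evenness of `G` under `k ↦ −k`, the predicate `G` holds on ALL of the
punctured ball of radius `N ≥ 3`.  The axis frequencies `m eᵢ` (`m > 0` without loss of
generality) are reached as `(m eᵢ + eⱼ) − eⱼ` for `2 ≤ m < N` and `((m−1)eᵢ + eⱼ) + (eᵢ − eⱼ)`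
for `m = N ≥ 3`; the threshold `N ≥ 3` is sharp (`(±2,0,0)` at `N = 2`).
-/

namespace Summit.AnomalousDissipation.AnomalousDissipation.Theorems.MomentParityCubicParityLoud

open Matrix

set_option linter.dupNamespace false

set_option maxHeartbeats 800000 in
/-- **Propagation to the whole frequency ball.** [folklore] -/
theorem lattice_all :
    ∀ (N : ℕ) (S : Finset (Fin 3 → ℤ)) (G : (Fin 3 → ℤ) → Prop), 3 ≤ N →
    (∀ k : Fin 3 → ℤ, k ∈ S ↔ k ≠ 0 ∧ k ⬝ᵥ k ≤ (N : ℤ) ^ 2) →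
    (∀ k ∈ S, k ⬝ᵥ k ≤ 2 → ((k 0 ≠ 0 ∧ k 1 ≠ 0) ∨ (k 0 ≠ 0 ∧ k 2 ≠ 0) ∨ (k 1 ≠ 0 ∧ k 2 ≠ 0)) → G k) →
    (∀ (i : Fin 3) (s : ℤ), (s = 1 ∨ s = -1) → G (Pi.single i s)) →
    (∀ a ∈ S, ∀ b ∈ S, ∀ c ∈ S, a + b = c → crossProduct a b ≠ 0 → a ⬝ᵥ a ≠ b ⬝ᵥ b → G a → G b → G c) →
    (∀ k ∈ S, G k → G (-k)) →
    ∀ k ∈ S, G k := by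
  intro N S G hN hmem G2 GE Gprop Gneg
  have hN2 : (9 : ℤ) ≤ (N : ℤ) ^ 2 := by
    have : (3 : ℤ) ≤ (N : ℤ) := by exact_mod_cast hN
    nlinarith
  have memS : ∀ k : Fin 3 → ℤ, k ≠ 0 → k ⬝ᵥ k ≤ 9 → k ∈ S := fun k h0 h9 =>
    (hmem k).2 ⟨h0, h9.trans hN2⟩
  have normk : ∀ k : Fin 3 → ℤ, k ⬝ᵥ k = k 0 ^ 2 + k 1 ^ 2 + k 2 ^ 2 := fun k => by
    rw [vec3_dotProduct]; ring
  have sq1 : ∀ x : ℤ, x ≠ 0 → 1 ≤ x ^ 2 := fun x hx => by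
    have : 0 < x ^ 2 := by positivity
    omega
  have claimA : ∀ n : ℕ, ∀ k ∈ S, k ⬝ᵥ k ≤ (n : ℤ) →
      ((k 0 ≠ 0 ∧ k 1 ≠ 0) ∨ (k 0 ≠ 0 ∧ k 2 ≠ 0) ∨ (k 1 ≠ 0 ∧ k 2 ≠ 0)) → G k :=
    fun n k hk _ hna => lattice_offaxis N S G hN hmem G2 GE Gprop k hk hna
  -- `-k ∈ S`
  have negS : ∀ k ∈ S, -k ∈ S := fun k hk => by
    rw [hmem] at hk ⊢
    exact ⟨neg_ne_zero.2 hk.1, by simpa using hk.2⟩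
  -- unit vectors and the norm-two vectors used on the axes
  have GU : ∀ v, v = (![1, 0, 0] : Fin 3 → ℤ) ∨ v = ![0, 1, 0] ∨ v = ![0, 0, 1] → G v := by
    rintro v (rfl | rfl | rfl)
    · convert GE 0 1 (Or.inl rfl) using 2; decide
    · convert GE 1 1 (Or.inl rfl) using 2; decide
    · convert GE 2 1 (Or.inl rfl) using 2; decide
  have Gm00 : G ![-1, 0, 0] := by convert GE 0 (-1) (Or.inr rfl) using 2; decide
  have G0m0 : G ![0, -1, 0] := by convert GE 1 (-1) (Or.inr rfl) using 2; decide
  have G00m : G ![0, 0, -1] := by convert GE 2 (-1) (Or.inr rfl) using 2; decide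
  have Gm10 : G ![-1, 1, 0] := G2 _ (memS _ (by decide) (by norm_num [vec3_dotProduct])) (by norm_num [vec3_dotProduct]) (by decide)
  have G10m : G ![1, 0, -1] := G2 _ (memS _ (by decide) (by norm_num [vec3_dotProduct])) (by norm_num [vec3_dotProduct]) (by decide)
  have axis0 : ∀ k ∈ S, k 1 = 0 → k 2 = 0 → 0 < k 0 → G k := by
    intro k hk hJ hK hpos
    obtain ⟨m, hm⟩ : ∃ m, k 0 = m := ⟨_, rfl⟩
    have hkv : k = ![m, 0, 0] := by ext i; fin_cases i <;> simp [hJ, hK, hm]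
    have hkk : k ⬝ᵥ k ≤ (N : ℤ) ^ 2 := ((hmem k).1 hk).2
    rw [hkv, normk] at hkk
    simp only [Fin.isValue, cons_val_zero, cons_val_one, cons_val_two, head_cons, tail_cons, 
      Nat.succ_eq_add_one, Nat.reduceAdd] at hkk
    rw [hm] at hpos
    have hmN : m ≤ (N : ℤ) := by nlinarith
    have hN' : (3 : ℤ) ≤ N := by exact_mod_cast hN
    rcases (show m = 1 ∨ (2 ≤ m ∧ m + 1 ≤ (N : ℤ)) ∨ (m = N ∧ 3 ≤ m) by omega) with h1 | ⟨h2, h3⟩ | ⟨h4, h5⟩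
    · rw [hkv, h1]; exact GU _ (Or.inl rfl)
    · obtain ⟨a, ha⟩ : ∃ a : Fin 3 → ℤ, a = ![m, 1, 0] := ⟨_, rfl⟩
      obtain ⟨b, hb⟩ : ∃ b : Fin 3 → ℤ, b = ![0, -1, 0] := ⟨_, rfl⟩
      have hab : a + b = k := by rw [hkv, ha, hb]; ext i; fin_cases i <;> simp
      have haa : a ⬝ᵥ a = m ^ 2 + 1 := by rw [ha, normk]; simp only [Fin.isValue, cons_val_zero, cons_val_one, cons_val_two, head_cons, tail_cons]; ring
      have ha0 : a ≠ 0 := by rw [ha]; intro h; have := congrFun h 1; simp at this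
      have ha_mem : a ∈ S := (hmem a).2 ⟨ha0, by rw [haa]; nlinarith⟩
      have hb_mem : b ∈ S := memS b (by rw [hb]; decide) (by rw [hb]; norm_num [vec3_dotProduct])
      have Gb : G b := by rw [hb]; exact G0m0
      have Ga : G a := claimA (Int.toNat (a ⬝ᵥ a)) a ha_mem (Int.self_le_toNat _)
        (by rw [ha]; simp only [Fin.isValue, cons_val_zero, cons_val_one, cons_val_two, head_cons, tail_cons]; exact Or.inl ⟨by omega, by omega⟩)
      have hcross : crossProduct a b ≠ 0 := by
        rw [ha, hb]; intro h
        have hc0 := congrFun h 0; have hc1 := congrFun h 1; have hc2 := congrFun h 2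
        simp [cross_apply] at hc0 hc1 hc2
        omega
      have hne : a ⬝ᵥ a ≠ b ⬝ᵥ b := by
        rw [haa, hb, normk]; simp only [Fin.isValue, cons_val_zero, cons_val_one, cons_val_two, head_cons, tail_cons]; nlinarith
      exact Gprop a ha_mem b hb_mem k hk hab hcross hne Ga Gb
    · obtain ⟨a, ha⟩ : ∃ a : Fin 3 → ℤ, a = ![m - 1, 1, 0] := ⟨_, rfl⟩
      obtain ⟨b, hb⟩ : ∃ b : Fin 3 → ℤ, b = ![1, -1, 0] := ⟨_, rfl⟩
      have hab : a + b = k := by rw [hkv, ha, hb]; ext i; fin_cases i <;> simp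
      have haa : a ⬝ᵥ a = (m - 1) ^ 2 + 1 := by rw [ha, normk]; simp only [Fin.isValue, cons_val_zero, cons_val_one, cons_val_two, head_cons, tail_cons]; ring
      have ha0 : a ≠ 0 := by rw [ha]; intro h; have := congrFun h 1; simp at this
      have ha_mem : a ∈ S := (hmem a).2 ⟨ha0, by rw [haa]; nlinarith⟩
      have hb_mem : b ∈ S := memS b (by rw [hb]; decide) (by rw [hb]; norm_num [vec3_dotProduct])
      have Gb : G b := by rw [hb]; exact (by simpa using Gneg _ (memS _ (by decide) (by norm_num [vec3_dotProduct])) Gm10)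
      have Ga : G a := claimA (Int.toNat (a ⬝ᵥ a)) a ha_mem (Int.self_le_toNat _)
        (by rw [ha]; simp only [Fin.isValue, cons_val_zero, cons_val_one, cons_val_two, head_cons, tail_cons]; exact Or.inl ⟨by omega, by omega⟩)
      have hcross : crossProduct a b ≠ 0 := by
        rw [ha, hb]; intro h
        have hc0 := congrFun h 0; have hc1 := congrFun h 1; have hc2 := congrFun h 2
        simp [cross_apply] at hc0 hc1 hc2
        omega
      have hne : a ⬝ᵥ a ≠ b ⬝ᵥ b := by
        rw [haa, hb, normk]; simp only [Fin.isValue, cons_val_zero, cons_val_one, cons_val_two, head_cons, tail_cons]; nlinarith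
      exact Gprop a ha_mem b hb_mem k hk hab hcross hne Ga Gb
  have axis1 : ∀ k ∈ S, k 0 = 0 → k 2 = 0 → 0 < k 1 → G k := by
    intro k hk hJ hK hpos
    obtain ⟨m, hm⟩ : ∃ m, k 1 = m := ⟨_, rfl⟩
    have hkv : k = ![0, m, 0] := by ext i; fin_cases i <;> simp [hJ, hK, hm]
    have hkk : k ⬝ᵥ k ≤ (N : ℤ) ^ 2 := ((hmem k).1 hk).2
    rw [hkv, normk] at hkk
    simp only [Fin.isValue, cons_val_zero, cons_val_one, cons_val_two, head_cons, tail_cons, 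
      Nat.succ_eq_add_one, Nat.reduceAdd] at hkk
    rw [hm] at hpos
    have hmN : m ≤ (N : ℤ) := by nlinarith
    have hN' : (3 : ℤ) ≤ N := by exact_mod_cast hN
    rcases (show m = 1 ∨ (2 ≤ m ∧ m + 1 ≤ (N : ℤ)) ∨ (m = N ∧ 3 ≤ m) by omega) with h1 | ⟨h2, h3⟩ | ⟨h4, h5⟩
    · rw [hkv, h1]; exact GU _ (Or.inr (Or.inl rfl))
    · obtain ⟨a, ha⟩ : ∃ a : Fin 3 → ℤ, a = ![1, m, 0] := ⟨_, rfl⟩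
      obtain ⟨b, hb⟩ : ∃ b : Fin 3 → ℤ, b = ![-1, 0, 0] := ⟨_, rfl⟩
      have hab : a + b = k := by rw [hkv, ha, hb]; ext i; fin_cases i <;> simp
      have haa : a ⬝ᵥ a = m ^ 2 + 1 := by rw [ha, normk]; simp only [Fin.isValue, cons_val_zero, cons_val_one, cons_val_two, head_cons, tail_cons]; ring
      have ha0 : a ≠ 0 := by rw [ha]; intro h; have := congrFun h 0; simp at this
      have ha_mem : a ∈ S := (hmem a).2 ⟨ha0, by rw [haa]; nlinarith⟩
      have hb_mem : b ∈ S := memS b (by rw [hb]; decide) (by rw [hb]; norm_num [vec3_dotProduct])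
      have Gb : G b := by rw [hb]; exact Gm00
      have Ga : G a := claimA (Int.toNat (a ⬝ᵥ a)) a ha_mem (Int.self_le_toNat _)
        (by rw [ha]; simp only [Fin.isValue, cons_val_zero, cons_val_one, cons_val_two, head_cons, tail_cons]; exact Or.inl ⟨by omega, by omega⟩)
      have hcross : crossProduct a b ≠ 0 := by
        rw [ha, hb]; intro h
        have hc0 := congrFun h 0; have hc1 := congrFun h 1; have hc2 := congrFun h 2
        simp [cross_apply] at hc0 hc1 hc2
        omega
      have hne : a ⬝ᵥ a ≠ b ⬝ᵥ b := by
        rw [haa, hb, normk]; simp only [Fin.isValue, cons_val_zero, cons_val_one, cons_val_two, head_cons, tail_cons]; nlinarith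
      exact Gprop a ha_mem b hb_mem k hk hab hcross hne Ga Gb
    · obtain ⟨a, ha⟩ : ∃ a : Fin 3 → ℤ, a = ![1, m - 1, 0] := ⟨_, rfl⟩
      obtain ⟨b, hb⟩ : ∃ b : Fin 3 → ℤ, b = ![-1, 1, 0] := ⟨_, rfl⟩
      have hab : a + b = k := by rw [hkv, ha, hb]; ext i; fin_cases i <;> simp
      have haa : a ⬝ᵥ a = (m - 1) ^ 2 + 1 := by rw [ha, normk]; simp only [Fin.isValue, cons_val_zero, cons_val_one, cons_val_two, head_cons, tail_cons]; ring
      have ha0 : a ≠ 0 := by rw [ha]; intro h; have := congrFun h 0; simp at this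
      have ha_mem : a ∈ S := (hmem a).2 ⟨ha0, by rw [haa]; nlinarith⟩
      have hb_mem : b ∈ S := memS b (by rw [hb]; decide) (by rw [hb]; norm_num [vec3_dotProduct])
      have Gb : G b := by rw [hb]; exact Gm10
      have Ga : G a := claimA (Int.toNat (a ⬝ᵥ a)) a ha_mem (Int.self_le_toNat _)
        (by rw [ha]; simp only [Fin.isValue, cons_val_zero, cons_val_one, cons_val_two, head_cons, tail_cons]; exact Or.inl ⟨by omega, by omega⟩)
      have hcross : crossProduct a b ≠ 0 := by
        rw [ha, hb]; intro h
        have hc0 := congrFun h 0; have hc1 := congrFun h 1; have hc2 := congrFun h 2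
        simp [cross_apply] at hc0 hc1 hc2
        omega
      have hne : a ⬝ᵥ a ≠ b ⬝ᵥ b := by
        rw [haa, hb, normk]; simp only [Fin.isValue, cons_val_zero, cons_val_one, cons_val_two, head_cons, tail_cons]; nlinarith
      exact Gprop a ha_mem b hb_mem k hk hab hcross hne Ga Gb
  have axis2 : ∀ k ∈ S, k 0 = 0 → k 1 = 0 → 0 < k 2 → G k := by
    intro k hk hJ hK hpos
    obtain ⟨m, hm⟩ : ∃ m, k 2 = m := ⟨_, rfl⟩
    have hkv : k = ![0, 0, m] := by ext i; fin_cases i <;> simp [hJ, hK, hm]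
    have hkk : k ⬝ᵥ k ≤ (N : ℤ) ^ 2 := ((hmem k).1 hk).2
    rw [hkv, normk] at hkk
    simp only [Fin.isValue, cons_val_zero, cons_val_one, cons_val_two, head_cons, tail_cons, 
      Nat.succ_eq_add_one, Nat.reduceAdd] at hkk
    rw [hm] at hpos
    have hmN : m ≤ (N : ℤ) := by nlinarith
    have hN' : (3 : ℤ) ≤ N := by exact_mod_cast hN
    rcases (show m = 1 ∨ (2 ≤ m ∧ m + 1 ≤ (N : ℤ)) ∨ (m = N ∧ 3 ≤ m) by omega) with h1 | ⟨h2, h3⟩ | ⟨h4, h5⟩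
    · rw [hkv, h1]; exact GU _ (Or.inr (Or.inr rfl))
    · obtain ⟨a, ha⟩ : ∃ a : Fin 3 → ℤ, a = ![1, 0, m] := ⟨_, rfl⟩
      obtain ⟨b, hb⟩ : ∃ b : Fin 3 → ℤ, b = ![-1, 0, 0] := ⟨_, rfl⟩
      have hab : a + b = k := by rw [hkv, ha, hb]; ext i; fin_cases i <;> simp
      have haa : a ⬝ᵥ a = m ^ 2 + 1 := by rw [ha, normk]; simp only [Fin.isValue, cons_val_zero, cons_val_one, cons_val_two, head_cons, tail_cons]; ring
      have ha0 : a ≠ 0 := by rw [ha]; intro h; have := congrFun h 0; simp at this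
      have ha_mem : a ∈ S := (hmem a).2 ⟨ha0, by rw [haa]; nlinarith⟩
      have hb_mem : b ∈ S := memS b (by rw [hb]; decide) (by rw [hb]; norm_num [vec3_dotProduct])
      have Gb : G b := by rw [hb]; exact Gm00
      have Ga : G a := claimA (Int.toNat (a ⬝ᵥ a)) a ha_mem (Int.self_le_toNat _)
        (by rw [ha]; simp only [Fin.isValue, cons_val_zero, cons_val_one, cons_val_two, head_cons, tail_cons]; exact (fun h => Or.inr (Or.inl h)) ⟨by omega, by omega⟩)
      have hcross : crossProduct a b ≠ 0 := by
        rw [ha, hb]; intro h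
        have hc0 := congrFun h 0; have hc1 := congrFun h 1; have hc2 := congrFun h 2
        simp [cross_apply] at hc0 hc1 hc2
        omega
      have hne : a ⬝ᵥ a ≠ b ⬝ᵥ b := by
        rw [haa, hb, normk]; simp only [Fin.isValue, cons_val_zero, cons_val_one, cons_val_two, head_cons, tail_cons]; nlinarith
      exact Gprop a ha_mem b hb_mem k hk hab hcross hne Ga Gb
    · obtain ⟨a, ha⟩ : ∃ a : Fin 3 → ℤ, a = ![1, 0, m - 1] := ⟨_, rfl⟩
      obtain ⟨b, hb⟩ : ∃ b : Fin 3 → ℤ, b = ![-1, 0, 1] := ⟨_, rfl⟩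
      have hab : a + b = k := by rw [hkv, ha, hb]; ext i; fin_cases i <;> simp
      have haa : a ⬝ᵥ a = (m - 1) ^ 2 + 1 := by rw [ha, normk]; simp only [Fin.isValue, cons_val_zero, cons_val_one, cons_val_two, head_cons, tail_cons]; ring
      have ha0 : a ≠ 0 := by rw [ha]; intro h; have := congrFun h 0; simp at this
      have ha_mem : a ∈ S := (hmem a).2 ⟨ha0, by rw [haa]; nlinarith⟩
      have hb_mem : b ∈ S := memS b (by rw [hb]; decide) (by rw [hb]; norm_num [vec3_dotProduct])
      have Gb : G b := by rw [hb]; exact (by simpa using Gneg _ (memS _ (by decide) (by norm_num [vec3_dotProduct])) G10m)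
      have Ga : G a := claimA (Int.toNat (a ⬝ᵥ a)) a ha_mem (Int.self_le_toNat _)
        (by rw [ha]; simp only [Fin.isValue, cons_val_zero, cons_val_one, cons_val_two, head_cons, tail_cons]; exact (fun h => Or.inr (Or.inl h)) ⟨by omega, by omega⟩)
      have hcross : crossProduct a b ≠ 0 := by
        rw [ha, hb]; intro h
        have hc0 := congrFun h 0; have hc1 := congrFun h 1; have hc2 := congrFun h 2
        simp [cross_apply] at hc0 hc1 hc2
        omega
      have hne : a ⬝ᵥ a ≠ b ⬝ᵥ b := by
        rw [haa, hb, normk]; simp only [Fin.isValue, cons_val_zero, cons_val_one, cons_val_two, head_cons, tail_cons]; nlinarith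
      exact Gprop a ha_mem b hb_mem k hk hab hcross hne Ga Gb
  -- conclusion
  intro k hk
  by_cases hna : (k 0 ≠ 0 ∧ k 1 ≠ 0) ∨ (k 0 ≠ 0 ∧ k 2 ≠ 0) ∨ (k 1 ≠ 0 ∧ k 2 ≠ 0)
  · exact claimA (Int.toNat (k ⬝ᵥ k)) k hk (Int.self_le_toNat _) hna
  have hk0 : k ≠ 0 := ((hmem k).1 hk).1
  have key : ∀ (i : Fin 3), (∀ q ∈ S, (∀ j, j ≠ i → q j = 0) → 0 < q i → G q) →
      (∀ j, j ≠ i → k j = 0) → G k := by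
    intro i hax hz
    have hki : k i ≠ 0 := fun h => hk0 (by
      ext j; by_cases hj : j = i
      · rw [hj, h]; rfl
      · exact hz j hj)
    rcases lt_or_gt_of_ne hki with hneg | hpos
    · have h1 := hax (-k) (negS k hk) (fun j hj => by simp [hz j hj]) (by simp; linarith)
      simpa using Gneg (-k) (negS k hk) h1
    · exact hax k hk hz hpos
  push Not at hna
  by_cases h0 : k 0 = 0
  · by_cases h1 : k 1 = 0
    · refine key 2 (fun q hq hz hp => axis2 q hq (hz 0 (by decide)) (hz 1 (by decide)) hp) ?_
      intro j hj; fin_cases j <;> [exact h0; exact h1; exact absurd rfl hj]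
    · have h2 : k 2 = 0 := hna.2.2 h1
      refine key 1 (fun q hq hz hp => axis1 q hq (hz 0 (by decide)) (hz 2 (by decide)) hp) ?_
      intro j hj; fin_cases j <;> [exact h0; exact absurd rfl hj; exact h2]
  · have h1 : k 1 = 0 := hna.1 h0
    have h2 : k 2 = 0 := hna.2.1 h0
    refine key 0 (fun q hq hz hp => axis0 q hq (hz 1 (by decide)) (hz 2 (by decide)) hp) ?_
    intro j hj; fin_cases j <;> [exact absurd rfl hj; exact h1; exact h2]

end Summit.AnomalousDissipation.AnomalousDissipation.Theorems.MomentParityCubicParityLoud
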